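import Summits.QuantumFields.YangMills.Theorems.SoloBlindExpObservable
import HarnessLib

/-!
# SoloBlind: the chessboard doubling on the odd torus (`YangMills`)

Solo seat `solo-QuantumFields-blind`, deliverable D12, part 2 of 3.

Iterated reflection-positivity Schwarz inequalities for the exponential observables
`F_A = exp(c ∑_{q∈A} φ_q)` of `SoloBlindExpObservable` on the torus `Λ_L = (ℤ/Lℤ)^d`, `L ≥ 3`
**odd**, `β ≥ 0`, continuous `ρ`, with the odd ("site") reflection `t ↦ 1 - t` of
`SoloBlindOddTorusRP` (`wilsonExpectation_odd_timeReflect_mul_ge`: positive on bounded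
observables of the links of the half `1 ≤ t ≤ L/2`):

* `doubleStep`: if every plaquette of `A` has base time in `[0, n)`, `n ≤ L/2`, there is `A'`
  with base times in `[0, 2n+1)`, the same vanishing spatial base coordinates, and
  `⟨F_A⟩² ≤ ⟨F_{A'}⟩` — translate by `e₀` into the positive half,
  `⟨F⟩² = ⟨ΘF⟩⟨F⟩ ≤ ⟨ΘF · F⟩ = ⟨F_{ϑA₁ ∪ A₁}⟩`, translate by `n e₀`;
* `timeRound`: `k` doubling steps, `⟨F_A⟩^{2^k} ≤ ⟨F_{A'}⟩` whenever `2^k (n+1) ≤ L + 1`;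
* `roundStep`, `allRounds`: exchanging the axes `0 ↔ r` between the rounds runs the doubling in
  every coordinate direction: from a set based at the origin, `⟨F_A⟩^{2^{k r}} ≤ ⟨F_{A'}⟩` after
  `r ≤ d` rounds (`2^{k+1} ≤ L + 1`).

This is the odd-torus replacement for the chessboard estimate [FILS78, Thm 4.3] (J. Fröhlich,
R. Israel, E. H. Lieb, B. Simon, Comm. Math. Phys. 62 (1978) 1–34), whose site-reflection
pairing of time slices needs even `L`; cf. [Se82] E. Seiler, LNP 159 (1982), Ch. 4.  Elementary
given the tree's reflection positivity ([folklore]).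
-/

open MeasureTheory Filter Topology
open Literature.MathematicalPhysics.QuantumFieldTheory Literature.MathematicalPhysics.QuantumLattice

noncomputable section

namespace Summit.QuantumFields.YangMills.Theorems.SoloBlind

/-! ### Time arithmetic on the odd torus -/

section Arith

variable {L : ℕ} [NeZero L]

/-- `(a + n).val` for `n < L`. [folklore] -/
theorem val_add_natCast_of_lt (a : ZMod L) {n : ℕ} (hn : n < L) :
    (a + n).val = if a.val + n < L then a.val + n else a.val + n - L := by
  rw [ZMod.val_add, ZMod.val_natCast, Nat.mod_eq_of_lt hn]
  have ha := ZMod.val_lt a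
  split_ifs with h
  · exact Nat.mod_eq_of_lt h
  · rw [Nat.mod_eq_sub_mod (not_lt.1 h), Nat.mod_eq_of_lt (by omega)]

end Arith

/-! ### The doubling step: reflection positivity + translation -/

section Doubling

variable {d L N : ℕ} [NeZero d] [NeZero L] {G : Type*} [Group G] [TopologicalSpace G]
  [IsTopologicalGroup G] [CompactSpace G] [MeasurableSpace G] [BorelSpace G]
  (ρ : G →* Matrix (Fin N) (Fin N) ℂ)

omit [NeZero L] in
/-- The base time of the reflected plaquette. [folklore] -/
theorem val_plaqReflect_fst_zero [Fact (1 < L)] (q : Plaquette d L) :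
    ((WilsonRP.plaqReflect q).1 0).val =
      if q.2.1.1 = 0 then (if (q.1 0).val = 0 then 0 else L - (q.1 0).val)
      else (if (q.1 0).val = 0 then 1 else if (q.1 0).val = 1 then 0 else L + 1 - (q.1 0).val) := by
  unfold WilsonRP.plaqReflect
  by_cases h : q.2.1.1 = 0
  · simp only [h, ↓reduceIte]
    exact WilsonRP.val_timeReflect_shift_zero q.1
  · simp only [h, ↓reduceIte]
    exact WilsonRP.val_timeReflect q.1

/-- For a plaquette with base time `1 ≤ s ≤ n`, `2n < L`: the reflected plaquette has base time
outside `[1, n]`, and after translation by `n e₀` its base time is `≤ n`. [folklore] -/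
theorem plaqReflect_time_facts [Fact (1 < L)] (q : Plaquette d L) {n : ℕ}
    (h1 : 1 ≤ (q.1 0).val) (h2 : (q.1 0).val ≤ n) (h3 : 2 * n < L) :
    ¬ (1 ≤ ((WilsonRP.plaqReflect q).1 0).val ∧ ((WilsonRP.plaqReflect q).1 0).val ≤ n) ∧
      (((WilsonRP.plaqReflect q).1 0) + (n : ZMod L)).val ≤ n := by
  have hv := val_plaqReflect_fst_zero q
  have key : ((WilsonRP.plaqReflect q).1 0).val = 0 ∨
      L - n ≤ ((WilsonRP.plaqReflect q).1 0).val := by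
    rw [hv]
    split_ifs <;> omega
  have hlt := ZMod.val_lt ((WilsonRP.plaqReflect q).1 0)
  rw [val_add_natCast_of_lt _ (show n < L by omega)]
  constructor
  · omega
  · split_ifs with h <;> omega

omit [NeZero d] [NeZero L] [TopologicalSpace G] [IsTopologicalGroup G] [CompactSpace G]
  [MeasurableSpace G] [BorelSpace G] in
/-- `F_X · F_Y = F_{X ∪ Y}` for disjoint `X, Y`. [folklore] -/
theorem expObs_mul_of_disjoint (c : ℝ) {X Y : Finset (Plaquette d L)} (h : Disjoint X Y)
    (U : GaugeConfig d L G) : expObs ρ c X U * expObs ρ c Y U = expObs ρ c (X ∪ Y) U := by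
  unfold expObs
  rw [← Real.exp_add, Finset.sum_union h, mul_add]

omit [TopologicalSpace G] [IsTopologicalGroup G] [CompactSpace G] [MeasurableSpace G]
  [BorelSpace G] in
/-- `F_A` lives in the closed positive half of the odd torus when every plaquette of `A` is
positive (`1 ≤ t ≤ L/2`). [folklore] -/
theorem dependsOn_expObs_of_pos (hL : Odd L) [Fact (1 < L)] (c : ℝ) {A : Finset (Plaquette d L)}
    (hA : ∀ q ∈ A, WilsonOddRP.IsOPosPlaq q) :
    DependsOn (expObs (G := G) ρ c A)
      ((WilsonOddRP.oPosEdges ∪ WilsonOddRP.oSharedEdges : Finset (Edge d L)) :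
        Set (Edge d L)) := by
  intro U V hUV
  unfold expObs
  congr 2
  refine Finset.sum_congr rfl fun q hq => ?_
  obtain ⟨h1, h2, h3, h4⟩ := WilsonOddRP.edges_of_isOPosPlaq hL (hA q hq)
  have h : ∀ e, WilsonOddRP.IsOPosEdge e ∨ WilsonOddRP.IsOSharedEdge e → U e = V e :=
    fun e he => hUV e (by rcases he with he | he <;> simp [he])
  simp only [plaquetteCost, plaquetteHolonomy, h _ h1, h _ h2, h _ h3, h _ h4]

/-- **The doubling step.** If every plaquette of `A` has base time `< n ≤ L/2` (`L ≥ 3` odd,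
`β ≥ 0`), there is a set `A'` with base times `< 2n + 1`, the same vanishing spatial coordinates,
and `⟨F_A⟩² ≤ ⟨F_{A'}⟩`: translate `A` by `e₀` into the positive half, apply reflection
positivity `⟨F⟩² = ⟨ΘF⟩⟨F⟩ ≤ ⟨ΘF · F⟩ = ⟨F_{ϑA ∪ A}⟩`, and translate by `n e₀`. [folklore] -/
theorem doubleStep (hL : Odd L) (hL3 : 3 ≤ L) (hρ : Continuous ρ) {β : ℝ} (hβ : 0 ≤ β) (c : ℝ)
    {n : ℕ} (hn : n ≤ L / 2) {A : Finset (Plaquette d L)} (hA : (∀ q ∈ A, (q.1 0).val < n)) :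
    ∃ A' : Finset (Plaquette d L), (∀ q ∈ A', (q.1 0).val < 2 * n + 1) ∧
      (∀ j : Fin d, j ≠ 0 → (∀ q ∈ A, q.1 j = 0) → (∀ q ∈ A', q.1 j = 0)) ∧
      wilsonExpectation ρ β (expObs (G := G) ρ c A) ^ 2 ≤
        wilsonExpectation ρ β (expObs (G := G) ρ c A') := by
  haveI : Fact (1 < L) := ⟨by omega⟩
  have hO := hL
  obtain ⟨m, hm⟩ := hL
  have h2n : 2 * n < L := by omega
  -- Step 1: translate into the positive half
  set A₁ : Finset (Plaquette d L) := plaqTranslate (Pi.single (0 : Fin d) (1 : ZMod L)) A with hA₁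
  have hA₁t : ∀ q ∈ A₁, 1 ≤ (q.1 0).val ∧ (q.1 0).val ≤ n := by
    intro q hq
    obtain ⟨q₀, hq₀, rfl⟩ := mem_plaqTranslate.1 hq
    have h0 := hA q₀ hq₀
    simp only [Pi.add_apply, Pi.single_eq_same]
    have h := val_add_natCast_of_lt (q₀.1 0) (n := 1) (by omega)
    rw [Nat.cast_one] at h
    rw [h, if_pos (by omega)]
    omega
  have hA₁z : ∀ j : Fin d, j ≠ 0 → (∀ q ∈ A, q.1 j = 0) → (∀ q ∈ A₁, q.1 j = 0) := by
    intro j hj hZ q hq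
    obtain ⟨q₀, hq₀, rfl⟩ := mem_plaqTranslate.1 hq
    simp only [Pi.add_apply, Pi.single_eq_of_ne hj, add_zero]
    exact hZ q₀ hq₀
  have hpos : ∀ q ∈ A₁, WilsonOddRP.IsOPosPlaq q := fun q hq =>
    ⟨(hA₁t q hq).1, (hA₁t q hq).2.trans hn⟩
  have hE₁ : wilsonExpectation ρ β (expObs (G := G) ρ c A₁) =
      wilsonExpectation ρ β (expObs ρ c A) :=
    wilsonExpectation_expObs_plaqTranslate ρ β c _ A
  -- Step 2: reflection positivity
  have hRP := wilsonExpectation_odd_timeReflect_mul_ge ρ hO hL3 hρ hβ (measurable_expObs ρ hρ c A₁)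
    (exists_abs_expObs_le ρ hρ c A₁) (dependsOn_expObs_of_pos ρ hO c hpos)
  rw [wilsonExpectation_comp_timeReflect ρ hρ] at hRP
  have hdisj : Disjoint (A₁.image WilsonRP.plaqReflect) A₁ := by
    refine Finset.disjoint_left.2 fun q hq hq' => ?_
    obtain ⟨q₀, hq₀, rfl⟩ := Finset.mem_image.1 hq
    exact (plaqReflect_time_facts q₀ (hA₁t q₀ hq₀).1 (hA₁t q₀ hq₀).2 h2n).1 (hA₁t _ hq')
  set B : Finset (Plaquette d L) := A₁.image WilsonRP.plaqReflect ∪ A₁ with hB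
  have hprod : (fun U : GaugeConfig d L G => expObs ρ c A₁ U.timeReflect * expObs ρ c A₁ U) =
      expObs ρ c B := by
    funext U
    rw [expObs_timeReflect ρ hρ, expObs_mul_of_disjoint ρ c hdisj]
  rw [hprod] at hRP
  -- Step 3: translate by `n e₀`
  set A' : Finset (Plaquette d L) := plaqTranslate (Pi.single (0 : Fin d) (n : ZMod L)) B with hA'
  refine ⟨A', ?_, ?_, ?_⟩
  · intro q hq
    obtain ⟨q', hq', rfl⟩ := mem_plaqTranslate.1 hq
    simp only [Pi.add_apply, Pi.single_eq_same]
    rcases Finset.mem_union.1 hq' with h | h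
    · obtain ⟨q₀, hq₀, rfl⟩ := Finset.mem_image.1 h
      have := (plaqReflect_time_facts q₀ (hA₁t q₀ hq₀).1 (hA₁t q₀ hq₀).2 h2n).2
      omega
    · have hs := hA₁t q' h
      rw [val_add_natCast_of_lt _ (show n < L by omega), if_pos (by omega)]
      omega
  · intro j hj hZ q hq
    obtain ⟨q', hq', rfl⟩ := mem_plaqTranslate.1 hq
    simp only [Pi.add_apply, Pi.single_eq_of_ne hj, add_zero]
    rcases Finset.mem_union.1 hq' with h | h
    · obtain ⟨q₀, hq₀, rfl⟩ := Finset.mem_image.1 h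
      -- the reflection does not move the spatial coordinates of the base point
      have hfix : (WilsonRP.plaqReflect q₀).1 j = q₀.1 j := by
        unfold WilsonRP.plaqReflect
        split_ifs
        · show (q₀.1.shift 0).timeReflect j = q₀.1 j
          rw [WilsonRP.timeReflect_apply_of_ne _ hj, WilsonRP.shift_apply_of_ne _ hj]
        · show q₀.1.timeReflect j = q₀.1 j
          rw [WilsonRP.timeReflect_apply_of_ne _ hj]
      rw [hfix]
      exact hA₁z j hj hZ q₀ hq₀
    · exact hA₁z j hj hZ q' h
  · rw [hA', wilsonExpectation_expObs_plaqTranslate, ← hE₁, sq]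
    exact hRP

/-- **The time round**: `k` doubling steps. If every plaquette of `A` has base time `< n` and
`2^k (n + 1) ≤ L + 1`, there is `A'` with the same vanishing spatial coordinates and
`⟨F_A⟩^{2^k} ≤ ⟨F_{A'}⟩`. [folklore] -/
theorem timeRound (hL : Odd L) (hL3 : 3 ≤ L) (hρ : Continuous ρ) {β : ℝ} (hβ : 0 ≤ β) (c : ℝ) :
    ∀ (k : ℕ) {n : ℕ} {A : Finset (Plaquette d L)}, (∀ q ∈ A, (q.1 0).val < n) →
      2 ^ k * (n + 1) ≤ L + 1 →
      ∃ A' : Finset (Plaquette d L),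
        (∀ j : Fin d, j ≠ 0 → (∀ q ∈ A, q.1 j = 0) → (∀ q ∈ A', q.1 j = 0)) ∧
        wilsonExpectation ρ β (expObs (G := G) ρ c A) ^ (2 ^ k) ≤
          wilsonExpectation ρ β (expObs (G := G) ρ c A') := by
  intro k
  induction k with
  | zero =>
    intro n A hA hk
    exact ⟨A, fun _ _ h => h, by simp⟩
  | succ k ih =>
    intro n A hA hk
    have h2k : 1 ≤ 2 ^ k := Nat.one_le_two_pow
    have hn : n ≤ L / 2 := by
      have h2 : 2 ≤ 2 ^ (k + 1) := by rw [pow_succ]; omega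
      have : 2 * (n + 1) ≤ 2 ^ (k + 1) * (n + 1) := Nat.mul_le_mul_right _ h2
      set t := 2 ^ (k + 1) * (n + 1) with ht
      omega
    obtain ⟨A₂, hA₂, hZ₂, hle₂⟩ := doubleStep ρ hL hL3 hρ hβ c hn hA
    have hk' : 2 ^ k * (2 * n + 1 + 1) ≤ L + 1 :=
      calc 2 ^ k * (2 * n + 1 + 1) = 2 ^ (k + 1) * (n + 1) := by ring
        _ ≤ L + 1 := hk
    obtain ⟨A', hZ', hle'⟩ := ih hA₂ hk'
    refine ⟨A', fun j hj h => hZ' j hj (hZ₂ j hj h), ?_⟩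
    calc wilsonExpectation ρ β (expObs ρ c A) ^ 2 ^ (k + 1)
        = (wilsonExpectation ρ β (expObs ρ c A) ^ 2) ^ 2 ^ k := by rw [pow_succ', pow_mul]
      _ ≤ wilsonExpectation ρ β (expObs ρ c A₂) ^ 2 ^ k := pow_le_pow_left₀ (sq_nonneg _) hle₂ _
      _ ≤ _ := hle'

/-! ### All directions: axis exchange between the time rounds -/

/-- **One direction.** Exchange the axes `0` and `r` (so that the vanishing coordinate `r`
becomes the time) and run the time round. [folklore] -/
theorem roundStep (hL : Odd L) (hL3 : 3 ≤ L) (hρ : Continuous ρ) {β : ℝ} (hβ : 0 ≤ β) (c : ℝ)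
    {k : ℕ} (hk : 2 ^ (k + 1) ≤ L + 1) {r : ℕ} (hr : r < d) {A : Finset (Plaquette d L)}
    (hA : (∀ q ∈ A, ∀ j : Fin d, r ≤ j.val → q.1 j = 0)) :
    ∃ A' : Finset (Plaquette d L), (∀ q ∈ A', ∀ j : Fin d, r + 1 ≤ j.val → q.1 j = 0) ∧
      wilsonExpectation ρ β (expObs (G := G) ρ c A) ^ (2 ^ k) ≤
        wilsonExpectation ρ β (expObs (G := G) ρ c A') := by
  set i : Fin d := ⟨r, hr⟩ with hi
  set A₁ : Finset (Plaquette d L) := A.image (plaqSwap 0 i) with hA₁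
  have hbox : (∀ q ∈ A₁, (q.1 0).val < 1) := by
    intro q hq
    obtain ⟨q₀, hq₀, rfl⟩ := Finset.mem_image.1 hq
    rw [plaqSwap_fst, Equiv.swap_apply_left, hA q₀ hq₀ i (by simp [hi]), ZMod.val_zero]
    exact Nat.one_pos
  have hzero : ∀ j : Fin d, r + 1 ≤ j.val → (∀ q ∈ A₁, q.1 j = 0) := by
    intro j hj q hq
    obtain ⟨q₀, hq₀, rfl⟩ := Finset.mem_image.1 hq
    have hj0 : j ≠ 0 := by
      intro h
      rw [h, Fin.val_zero] at hj
      omega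
    have hji : j ≠ i := by
      intro h
      rw [h, hi] at hj
      simp at hj
    rw [plaqSwap_fst, Equiv.swap_apply_of_ne_of_ne hj0 hji]
    exact hA q₀ hq₀ j (by omega)
  have hk1 : 2 ^ k * (1 + 1) ≤ L + 1 := by
    calc 2 ^ k * (1 + 1) = 2 ^ (k + 1) := by ring
      _ ≤ L + 1 := hk
  obtain ⟨A', hZ', hle'⟩ := timeRound ρ hL hL3 hρ hβ c k hbox hk1
  refine ⟨A', ?_, ?_⟩
  · intro q hq j hj
    have hj0 : j ≠ 0 := by
      intro h
      rw [h, Fin.val_zero] at hj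
      omega
    exact hZ' j hj0 (hzero j hj) q hq
  · rw [hA₁, wilsonExpectation_expObs_swap ρ hρ β c 0 i A] at hle'
    exact hle'

/-- **All `d` directions**: from a set of plaquettes based at the origin, `r ≤ d` rounds give
`⟨F_A⟩^{2^{k r}} ≤ ⟨F_{A'}⟩`. [folklore] -/
theorem allRounds (hL : Odd L) (hL3 : 3 ≤ L) (hρ : Continuous ρ) {β : ℝ} (hβ : 0 ≤ β) (c : ℝ)
    {k : ℕ} (hk : 2 ^ (k + 1) ≤ L + 1) :
    ∀ (r : ℕ), r ≤ d → ∀ {A : Finset (Plaquette d L)},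
      (∀ q ∈ A, ∀ j : Fin d, 0 ≤ j.val → q.1 j = 0) →
      ∃ A' : Finset (Plaquette d L), (∀ q ∈ A', ∀ j : Fin d, r ≤ j.val → q.1 j = 0) ∧
        wilsonExpectation ρ β (expObs (G := G) ρ c A) ^ (2 ^ (k * r)) ≤
          wilsonExpectation ρ β (expObs (G := G) ρ c A') := by
  intro r
  induction r with
  | zero =>
    intro _ A hA
    exact ⟨A, hA, by simp⟩
  | succ r ih =>
    intro hr A hA
    obtain ⟨A₁, hZ₁, hle₁⟩ := ih (by omega) hA
    obtain ⟨A', hZ', hle'⟩ := roundStep ρ hL hL3 hρ hβ c hk (show r < d by omega) hZ₁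
    refine ⟨A', hZ', ?_⟩
    calc wilsonExpectation ρ β (expObs ρ c A) ^ 2 ^ (k * (r + 1))
        = (wilsonExpectation ρ β (expObs ρ c A) ^ 2 ^ (k * r)) ^ 2 ^ k := by
          rw [Nat.mul_succ, pow_add, pow_mul]
      _ ≤ wilsonExpectation ρ β (expObs ρ c A₁) ^ 2 ^ k :=
          pow_le_pow_left₀ (pow_nonneg (wilsonExpectation_expObs_nonneg ρ β c A) _) hle₁ _
      _ ≤ _ := hle'

end Doubling

end Summit.QuantumFields.YangMills.Theorems.SoloBlind
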